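import Summits.Ventures.PercRepro.C041ZoneOCubeCount
import Summits.Ventures.PercRepro.C041ZoneOCubeCS

/-!
# The ONE-ANCHOR ZONE (CS) is `(#F − #I)₊² ≤ #T₁ · #T₂` (p6, gen 28; mine-3's C-041.md §15 (b): «for one anchor
(CS) reads (F − I)² ≤ T₁·T₂»)

Setting of `C041ZoneOCubeCount` / `C041ZoneOCubeCS`, plain case, a single anchor `k`.  The counts of the ZONE (CS)
are the counts of the count form: `nValid {k} ∅ = #F + #T₁ + #T₂ − #I`, `nG1 = #T₂`, `nG2 = #T₁`
(`nValid_single_eq`, `nG1_single_eq`, `nG2_single_eq`), so **`zoneCSConj_single_iff`**: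
`ZoneCSConj {k} ∅ ↔ (#F − #I)² ≤ #T₁ · #T₂` — the valid all-red states are at most the geometric mean of the
type-1 and the type-2 states.
-/

namespace PercRepro

namespace ZoneZ

namespace ZoneData

open Finset CSCount

variable {V E T₁ T₂ : Type*} (Z : ZoneData V E T₁ T₂) (k : V)
variable [Fintype E] [DecidableEq E] [Fintype T₁] [DecidableEq T₁] [Fintype T₂] [DecidableEq T₂]

/-- The valid count of one anchor is `#Vset`. -/
theorem nValid_single_eq : Z.nValid {k} (∅ : Set V) = #(Z.Vset k) := by
  classical
  unfold nValid
  apply congrArg Finset.card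
  ext σ
  rw [Finset.mem_filter, Z.mem_Aset_empty, Z.mem_Vset]

/-- The `G1` count of one anchor is `#T₂`. -/
theorem nG1_single_eq : Z.nG1 {k} (∅ : Set V) = #(Z.T2set k) := by
  classical
  rw [← Z.card_G1set_eq_card_T2set k]
  unfold nG1
  apply congrArg Finset.card
  ext σ
  rw [Finset.mem_filter, Z.mem_Aset_empty, Z.mem_G1set]

/-- The `G2` count of one anchor is `#T₁`. -/
theorem nG2_single_eq : Z.nG2 {k} (∅ : Set V) = #(Z.T1set k) := by
  classical
  rw [← Z.card_G2set_eq_card_T1set k]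
  unfold nG2
  apply congrArg Finset.card
  ext σ
  rw [Finset.mem_filter, Z.mem_Aset_empty, Z.mem_G2set]

/-- **The ONE-ANCHOR ZONE (CS) in the count form**: `(#F − #I)₊² ≤ #T₁ · #T₂`. -/
theorem zoneCSConj_single_iff :
    Z.ZoneCSConj {k} (∅ : Set V) ↔ (#(Z.Fset k) - #(Z.Iset k)) ^ 2 ≤ #(Z.T1set k) * #(Z.T2set k) := by
  unfold ZoneCSConj CS
  rw [nValid_single_eq, nG1_single_eq, nG2_single_eq]
  have h1 := Z.card_Aset_eq_count k
  have h2 := Z.card_Vset_add_card_Iset k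
  have e : #(Z.Vset k) - #(Z.T2set k) - #(Z.T1set k) = #(Z.Fset k) - #(Z.Iset k) := by omega
  rw [e, mul_comm]

end ZoneData

end ZoneZ

end PercRepro
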